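import Summits.CriticalPhenomena.PercolationContinuityZ3.Theorems.PercNearOneGluingNoHeavyQuantExponentCeilings
import Literature.Barriers.CriticalPhenomena.KozmaNachmiasLemma23B3
import HarnessLib

/-!
# QUANT lane (p4 gen 18): the POINTWISE critical volume tail from the one-arm floor —
# `P_{p_c}(|C| ≥ n) ≥ (2d·3^{d−1})⁻¹ · n^{−(d−1)/2}` for every `n ≥ 1`, `d ≥ 2`; at `d = 2` this is pointwise `δ ≥ 2`

builds on p205010 (kernel theorem, internal audit signed; external expert review pending) — NOT used in this file.

Census V28 of P4-MODULUS (pointwise `P_{p_c}(|C| ≥ n) ≥ c/√n`): not in print for `d ≥ 3`, and NOT derivable from the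
generating-function / product bounds (`…QuantCritVolumeNoGo`, this generation).  The one-arm route, however, is pointwise: an
open path from `0` to `∂Λ_n` has at least `n + 1` vertices (`oneArmProb_le_real_clusterSizeGe`, tree), and the input-free
one-arm floor `π_{p_c}(n) ≥ (2d·3^{d−1})⁻¹ n^{−(d−1)/2}` (`ThetaModulus.oneArmProb_criticalProbI_ge_rpow`, gen 5) gives

* `real_clusterSizeGe_criticalProbI_ge_rpow` — **`P_{p_c}(|C| ≥ n) ≥ (2d·3^{d−1})⁻¹ · n^{−(d−1)/2}`**, every `d ≥ 2`, `n ≥ 1`;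
* `real_clusterSizeGe_criticalProbI_ge_inv_sqrt_two` — **`d = 2`: `P_{p_c(ℤ²)}(|C| ≥ n) ≥ 1/(12√n)`** — pointwise `δ ≥ 2` on `ℤ²`.

For `d = 3` the exponent is `1` (no better than the product bound `a_n ≥ c/n`, S88); for `d ≥ 4` it is worse.  HONEST:
bookkeeping on two tree theorems (the remark of P4-MODULUS S88 made a kernel statement); nothing new for `d ≥ 3`.

## References
* G. Kozma, A. Nachmias, J. Amer. Math. Soc. 24 (2011), Lemma 3.1 and proof of Lemma 2.3 [KozmaNachmias2011].
* G. Grimmett, *Percolation*, 2nd ed. (1999), Prop. (10.29) [GrimmettPercolation1999].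
-/

noncomputable section

namespace Summit.CriticalPhenomena.PercolationContinuityZ3.Theorems.CritVolumeNoGo

open MeasureTheory Literature.Probability.Percolation Literature.Probability.LatticeModels

variable {d : ℕ}

/-- **Pointwise critical volume tail from the one-arm floor**: for `d ≥ 2` and `n ≥ 1`,
`P_{p_c}(|C| ≥ n) ≥ (2d·3^{d−1})⁻¹ · n^{−(d−1)/2}`. [cite: KozmaNachmias2011, Lemma 3.1] -/
theorem real_clusterSizeGe_criticalProbI_ge_rpow (hd : 2 ≤ d) {n : ℕ} (hn : 1 ≤ n) :
    1 / (2 * d * (3 : ℝ) ^ (d - 1)) * (n : ℝ) ^ (-(((d : ℝ) - 1) / 2)) ≤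
      (bondPercolation (zdGraph d) (criticalProbI d)).real (clusterSizeGe (0 : Site d) n) :=
  calc 1 / (2 * d * (3 : ℝ) ^ (d - 1)) * (n : ℝ) ^ (-(((d : ℝ) - 1) / 2))
      ≤ oneArmProb d (criticalProbI d) n := ThetaModulus.oneArmProb_criticalProbI_ge_rpow hd hn
    _ ≤ (bondPercolation (zdGraph d) (criticalProbI d)).real (clusterSizeGe (0 : Site d) (n + 1)) :=
        Literature.Barriers.CriticalPhenomena.oneArmProb_le_real_clusterSizeGe (by omega) _ n
    _ ≤ (bondPercolation (zdGraph d) (criticalProbI d)).real (clusterSizeGe (0 : Site d) n) :=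
        measureReal_mono (clusterSizeGe_antitone (0 : Site d) (Nat.le_succ n)) (measure_ne_top _ _)

/-- **Pointwise `δ ≥ 2` on `ℤ²`**: `P_{p_c(ℤ²)}(|C| ≥ n) ≥ 1/(12√n)` for every `n ≥ 1`. [cite: KozmaNachmias2011, Lemma 3.1] -/
theorem real_clusterSizeGe_criticalProbI_ge_inv_sqrt_two {n : ℕ} (hn : 1 ≤ n) :
    1 / (12 * Real.sqrt n) ≤ (bondPercolation (zdGraph 2) (criticalProbI 2)).real (clusterSizeGe (0 : Site 2) n) := by
  have h := real_clusterSizeGe_criticalProbI_ge_rpow (d := 2) le_rfl hn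
  have hn0 : (0 : ℝ) < n := by exact_mod_cast hn
  have hpow : (n : ℝ) ^ (-((((2 : ℕ) : ℝ) - 1) / 2)) = 1 / Real.sqrt n := by
    rw [show (-((((2 : ℕ) : ℝ) - 1) / 2)) = -(1 / 2 : ℝ) by norm_num, Real.rpow_neg hn0.le, ← Real.sqrt_eq_rpow,
      inv_eq_one_div]
  have hconst : 1 / (2 * ((2 : ℕ) : ℝ) * (3 : ℝ) ^ (2 - 1)) = 1 / 12 := by norm_num
  rw [hpow, hconst] at h
  calc 1 / (12 * Real.sqrt n) = 1 / 12 * (1 / Real.sqrt n) := by ring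
    _ ≤ _ := h

end Summit.CriticalPhenomena.PercolationContinuityZ3.Theorems.CritVolumeNoGo

end
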